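import Mathlib
import HarnessLib

/-!
# Error families of the far-side kernel transfer: generic `L²` bookkeeping

Analysis support file (everything proved, no definitions) for the kernel-transfer inequality of the
far-side channel estimate (`FarChannelsKernelTransfer.lean`): the energy distance between a true
kernel datum and its exact inverse-square shadow is a sum of finitely many "error families"
`Σ_{k∈J} u_k` with `|u_k(x)| ≤ (|α_k| K m_k/|c_k|) x^{γ_k}`, `γ_k ≤ −1`, on `[ρ,∞)`, `ρ ≥ 1`. Here:
`c_{2k} = ∏_{i<ℓ}(2k−2i−1) ≠ 0` and `c_{2k+1} = 0` (`k < ℓ`) for the tower coefficients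
(`towerCoeff_even_ne_zero`, `towerCoeff_odd_eq_zero`); the generic bound
`∫_{x>ρ} (Σ_j u_j)² ≤ #J Σ_j M_j² ρ^{2γ_j+1}/(−2γ_j−1)` for `|u_j| ≤ M_j x^{γ_j}`, `γ_j < −1/2`
(`integral_Ioi_sq_sum_le`); the arithmetic of one family (`sum_family_bound`) and the packaged
estimate `∫_{x>ρ} (Σ_k u_k)² ≤ N K² L² C ρ⁻¹ Σ_k α_k² ρ^{e_k}` when `|m_k| ≤ L`, `c_k⁻² ≤ C`,
`#J ≤ N`, `2γ_k + 2 = e_k` (`family_sq_integral_le`). Route PhotonSphereChannels,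
`FixedModeChannels`, far side (stmt-FinalStateConjecture-10048). Folklore.
-/

noncomputable section

namespace Literature.Analysis.PDE

open MeasureTheory Set Filter Topology Finset

/-! ### The tower coefficients at even and odd indices -/

/-- `c_{2k} = ∏_{i<ℓ}(2k − 2i − 1)` is a product of odd integers, hence non-zero. [folklore] -/
theorem towerCoeff_even_ne_zero (ℓ k : ℕ) :
    (∏ i ∈ range ℓ, (((2 * k : ℕ) : ℝ) - 2 * i - 1)) ≠ 0 := by
  rw [Finset.prod_ne_zero_iff]
  intro i _ h
  have h2 : ((2 * k : ℕ) : ℝ) - 2 * i - 1 = 2 * ((k : ℝ) - i - 1) + 1 := by push_cast; ring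
  rw [h2] at h
  have hz : ∃ z : ℤ, ((k : ℝ) - i - 1) = z := ⟨(k : ℤ) - i - 1, by push_cast; ring⟩
  obtain ⟨z, hz⟩ := hz
  rw [hz] at h
  have : (2 * z + 1 : ℤ) = 0 := by exact_mod_cast h
  omega

/-- `c_{j} = 0` for odd `j < 2ℓ` (the factor `i = (j−1)/2` vanishes). [folklore] -/
theorem towerCoeff_odd_eq_zero {ℓ k : ℕ} (hk : k < ℓ) :
    (∏ i ∈ range ℓ, (((2 * k + 1 : ℕ) : ℝ) - 2 * i - 1)) = 0 := by
  rw [Finset.prod_eq_zero_iff]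
  exact ⟨k, mem_range.2 hk, by push_cast; ring⟩

/-! ### Integrating sums of power-bounded functions -/

/-- **`L²` bound for a finite sum of power-bounded functions on `(ρ, ∞)`.** [folklore] -/
theorem integral_Ioi_sq_sum_le {J : Finset ℕ} {u : ℕ → ℝ → ℝ} (hu : ∀ j ∈ J, Continuous (u j))
    {M γ : ℕ → ℝ} (hγ : ∀ j ∈ J, γ j < -(1 / 2 : ℝ)) {ρ : ℝ} (hρ : 1 ≤ ρ)
    (hb : ∀ j ∈ J, ∀ z, ρ ≤ z → |u j z| ≤ M j * z ^ (γ j)) :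
    IntegrableOn (fun z => (∑ j ∈ J, u j z) ^ 2) (Ioi ρ) ∧
      ∫ z in Ioi ρ, (∑ j ∈ J, u j z) ^ 2
        ≤ J.card * ∑ j ∈ J, M j ^ 2 * ρ ^ (2 * γ j + 1) / (-(2 * γ j) - 1) := by
  have hρ0 : 0 < ρ := by linarith
  -- the majorant
  set g : ℝ → ℝ := fun z => (J.card : ℝ) * ∑ j ∈ J, M j ^ 2 * z ^ (2 * γ j) with hg
  have hgi : IntegrableOn g (Ioi ρ) := by
    refine Integrable.const_mul (integrable_finsetSum _ fun j hj => ?_) _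
    exact (integrableOn_Ioi_rpow_of_lt (by linarith [hγ j hj]) hρ0).const_mul _
  have hpt : ∀ z ∈ Ioi ρ, (∑ j ∈ J, u j z) ^ 2 ≤ g z := by
    intro z hz
    have hz' : ρ ≤ z := le_of_lt hz
    have hz0 : 0 < z := hρ0.trans hz
    calc (∑ j ∈ J, u j z) ^ 2 ≤ J.card * ∑ j ∈ J, u j z ^ 2 := sq_sum_le_card_mul_sum_sq
      _ ≤ J.card * ∑ j ∈ J, M j ^ 2 * z ^ (2 * γ j) := by
          gcongr with j hj
          calc u j z ^ 2 = |u j z| ^ 2 := (sq_abs _).symm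
            _ ≤ (M j * z ^ γ j) ^ 2 := pow_le_pow_left₀ (abs_nonneg _) (hb j hj z hz') 2
            _ = M j ^ 2 * z ^ (2 * γ j) := by
                rw [mul_pow, ← Real.rpow_natCast (z ^ γ j) 2, ← Real.rpow_mul hz0.le]
                congr 1; congr 1; push_cast; ring
  have hcont : Continuous fun z => (∑ j ∈ J, u j z) ^ 2 := (continuous_finsetSum _ hu).pow 2
  have hint : IntegrableOn (fun z => (∑ j ∈ J, u j z) ^ 2) (Ioi ρ) :=
    Integrable.mono' hgi hcont.aestronglyMeasurable ((ae_restrict_iff' measurableSet_Ioi).2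
      (ae_of_all _ fun z hz => by
        rw [Real.norm_eq_abs, abs_of_nonneg (sq_nonneg _)]; exact hpt z hz))
  refine ⟨hint, ?_⟩
  calc ∫ z in Ioi ρ, (∑ j ∈ J, u j z) ^ 2 ≤ ∫ z in Ioi ρ, g z :=
        setIntegral_mono_on hint hgi measurableSet_Ioi hpt
    _ = J.card * ∑ j ∈ J, M j ^ 2 * ρ ^ (2 * γ j + 1) / (-(2 * γ j) - 1) := by
        simp only [hg]
        rw [MeasureTheory.integral_const_mul, integral_finsetSum _ fun j hj =>
          (integrableOn_Ioi_rpow_of_lt (by linarith [hγ j hj]) hρ0).const_mul _]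
        congr 1
        refine sum_congr rfl fun j hj => ?_
        rw [MeasureTheory.integral_const_mul, integral_Ioi_rpow_of_lt (by linarith [hγ j hj]) hρ0]
        have : 2 * γ j + 1 ≠ 0 := by linarith [hγ j hj]
        have : -(2 * γ j) - 1 ≠ 0 := by linarith [hγ j hj]
        field_simp
        ring

/-- Arithmetic of one error family: `Σ_k (|α_k| K m_k/|c_k|)² ρ^{2γ_k+1}/(−2γ_k−1) ≤ K² L² C ρ⁻¹ Σ_k α_k² ρ^{e_k}`
when `|m_k| ≤ L`, `c_k⁻² ≤ C`, `−2γ_k − 1 ≥ 1`, `2γ_k + 1 = e_k − 1`. [folklore] -/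
theorem sum_family_bound {J : Finset ℕ} {α m c γ e : ℕ → ℝ} {K C L ρ : ℝ} (hρ : 0 < ρ)
    (hm : ∀ k ∈ J, |m k| ≤ L) (hc : ∀ k ∈ J, ((c k) ^ 2)⁻¹ ≤ C)
    (hγ : ∀ k ∈ J, 1 ≤ -(2 * γ k) - 1) (he : ∀ k ∈ J, 2 * γ k + 1 = e k - 1) :
    ∑ k ∈ J, (|α k| * K * m k / |c k|) ^ 2 * ρ ^ (2 * γ k + 1) / (-(2 * γ k) - 1)
      ≤ K ^ 2 * L ^ 2 * C * ρ⁻¹ * ∑ k ∈ J, α k ^ 2 * ρ ^ (e k) := by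
  rw [Finset.mul_sum]
  refine Finset.sum_le_sum fun k hk => ?_
  have h1 : (|α k| * K * m k / |c k|) ^ 2 = α k ^ 2 * K ^ 2 * m k ^ 2 * ((c k) ^ 2)⁻¹ := by
    rw [div_pow, mul_pow, mul_pow, sq_abs, sq_abs, div_eq_mul_inv]
  have hρe : ρ ^ (2 * γ k + 1) = ρ⁻¹ * ρ ^ (e k) := by
    rw [he k hk, Real.rpow_sub_one hρ.ne']; ring
  rw [h1, hρe]
  have hm2 : m k ^ 2 ≤ L ^ 2 := by
    have h := hm k hk
    have h0 : 0 ≤ |m k| := abs_nonneg _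
    nlinarith [sq_abs (m k)]
  have hX : 0 ≤ α k ^ 2 * K ^ 2 * m k ^ 2 * ((c k) ^ 2)⁻¹ * (ρ⁻¹ * ρ ^ e k) := by positivity
  calc α k ^ 2 * K ^ 2 * m k ^ 2 * ((c k) ^ 2)⁻¹ * (ρ⁻¹ * ρ ^ e k) / (-(2 * γ k) - 1)
      ≤ α k ^ 2 * K ^ 2 * m k ^ 2 * ((c k) ^ 2)⁻¹ * (ρ⁻¹ * ρ ^ e k) := div_le_self hX (hγ k hk)
    _ = (α k ^ 2 * K ^ 2) * (m k ^ 2 * ((c k) ^ 2)⁻¹) * (ρ⁻¹ * ρ ^ e k) := by ring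
    _ ≤ (α k ^ 2 * K ^ 2) * (L ^ 2 * C) * (ρ⁻¹ * ρ ^ e k) := by
        apply mul_le_mul_of_nonneg_right _ (by positivity)
        apply mul_le_mul_of_nonneg_left _ (by positivity)
        exact mul_le_mul hm2 (hc k hk) (by positivity) (sq_nonneg _)
    _ = K ^ 2 * L ^ 2 * C * ρ⁻¹ * (α k ^ 2 * ρ ^ e k) := by ring

/-- **One error family, integrated.** From `|u_k(z)| ≤ (|α_k| K m_k/|c_k|) z^{γ_k}` with
`γ_k ≤ −1` on `[ρ,∞)`, `|m_k| ≤ L`, `c_k⁻² ≤ C`, `#J ≤ N`, `2γ_k + 1 = e_k − 1`: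
`∫_ρ^∞ (Σ_k u_k)² ≤ N · K² L² C ρ⁻¹ Σ_k α_k² ρ^{e_k}`. [folklore] -/
theorem family_sq_integral_le {J : Finset ℕ} {u : ℕ → ℝ → ℝ} {α m c γ e : ℕ → ℝ}
    {K C L N ρ : ℝ} (hu : ∀ k ∈ J, Continuous (u k)) (hγ : ∀ k ∈ J, γ k ≤ -1)
    (he : ∀ k ∈ J, 2 * γ k + 1 = e k - 1) (hρ : 1 ≤ ρ)
    (hb : ∀ k ∈ J, ∀ z, ρ ≤ z → |u k z| ≤ (|α k| * K * m k / |c k|) * z ^ (γ k))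
    (hm : ∀ k ∈ J, |m k| ≤ L) (hc : ∀ k ∈ J, ((c k) ^ 2)⁻¹ ≤ C) (hC : 0 ≤ C)
    (hN : (J.card : ℝ) ≤ N) :
    IntegrableOn (fun z => (∑ k ∈ J, u k z) ^ 2) (Ioi ρ) ∧
      ∫ z in Ioi ρ, (∑ k ∈ J, u k z) ^ 2
        ≤ N * (K ^ 2 * L ^ 2 * C * ρ⁻¹ * ∑ k ∈ J, α k ^ 2 * ρ ^ (e k)) := by
  have hρ0 : 0 < ρ := lt_of_lt_of_le one_pos hρ
  have F := integral_Ioi_sq_sum_le (M := fun k => |α k| * K * m k / |c k|) hu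
    (fun k hk => by linarith only [hγ k hk]) hρ hb
  have S := sum_family_bound (α := α) (m := m) (c := c) (K := K) (e := e) hρ0 hm hc
    (fun k hk => by linarith only [hγ k hk]) he
  have hN0 : 0 ≤ N := (Nat.cast_nonneg _).trans hN
  have hS : 0 ≤ K ^ 2 * L ^ 2 * C * ρ⁻¹ * ∑ k ∈ J, α k ^ 2 * ρ ^ (e k) := by positivity
  exact ⟨F.1, F.2.trans ((mul_le_mul_of_nonneg_left S (Nat.cast_nonneg _)).trans
    (mul_le_mul hN le_rfl hS hN0))⟩

end Literature.Analysis.PDE
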